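import Literature.Topology.FourManifolds.DehnSurgery
import Literature.Topology.FourManifolds.DehnSurgeryTubularNbhdProofs
import Literature.Topology.FourManifolds.SmallSetComplement
import Literature.AlgebraicTopology.FundamentalGroup.CellAttachmentPi1
import Literature.AlgebraicTopology.FundamentalGroup.InclHomTransport
import Literature.AlgebraicTopology.SingularHomology.CollapseMap
import HarnessLib

/-!
# The fundamental group of a Dehn surgery on a LINK is a quotient of the link group (van Kampen)

Topic `Literature/Topology/FourManifolds`; proofs companion of `DehnSurgery.lean` (integral Dehn
surgery on framed knots and links, relational form `IsIntegralSurgery` /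
`IsIntegralSurgeryLink`) and link-level sibling of `DehnSurgeryFundamentalGroup.lean` (which
treats ONE component completely: `π₁(S³_m(K)) ≅ π₁(S³ ∖ K) ⧸ ⟪longitude⟫`). Written by the
fact seat of the barrier
`Literature.Barriers.SmoothPoincare4.StrictPropertyTwoRBarrier` (Gompf–Scharlemann–Thompson
(2010), §7: the printed Property 2R would trivialise the presentations
`⟨x, y ∣ yxy = xyx, xⁿ⁺¹ = yⁿ⟩`), as the first brick of the `π₁`-theory of surgered 3-manifolds
on which that argument rests: *"Suppose `L` is an `n`-component framed link … Then surgery on `L`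
yields `#ₙ(S¹ × S²)`, whose fundamental group `G` is free on `n` generators … If we pick a
meridian of each component of `L` … we obtain `n` elements `{rᵢ}` that normally generate `G`"*
(GST §7). Everything here is **proved**; no definition and no named fact is introduced (the
punctured solid torus — the open solid torus off its core — is written as the set
`{b : ↥solidTorus | (b : ℝ² × S¹).1 ≠ 0}` throughout).

## Results

* `Link.isPathConnected_compl_carrier`, `Link.pathConnectedSpace_complement` — **the complement
  of a smooth link in `S³` is path connected** (general position: a finite union of `C¹` curves
  has codimension `2` and does not separate, Hurewicz–Wallman (1941), Thm. IV 4, through the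
  tree's `isPathConnected_compl_of_subset_iUnion_image`). The knot case was in the tree
  (`Knot.pathConnectedSpace_complement_holds`, by a different argument).
* `surjective_inclHomOfSubset_union_of_surjective_inter`,
  `surjective_inclHomOfSubset_union_biUnion`, `surjective_inclHom_of_union_iUnion_eq_univ` —
  the abstract van Kampen step (Hatcher (2002), Lemma 1.15): if `A`, `B` are open and path
  connected with `A ∩ B` path connected and `π₁(A ∩ B) → π₁(B)` onto, then
  `π₁(A) → π₁(A ∪ B)` is onto; iterated over finitely many pairwise disjoint pieces `B i`.
* `surjective_inclHom_puncturedSolidTorus` — every loop of the open solid torus `D̊² × S¹` is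
  homotopic to a loop off the core (straight-line homotopy in the disc factor);
  `isPathConnected_solidTorus`, `isPathConnected_puncturedSolidTorus`.
* `range_inter_range_eq_image_puncturedSolidTorus` — in the gluing data of
  `IsIntegralSurgeryLink` the link-complement piece meets the `i`-th solid torus exactly in the
  punctured solid torus.
* **`pathConnectedSpace_and_surjective_inclHom_range_of_surgeryGluing`,
  `surjective_fundamentalGroup_map_of_surgeryGluing`** — for the gluing data
  `(jA : S³ ∖ L → Y, jB i : D̊² × S¹ → Y)` of a Dehn surgery on a link with finitely many
  components: `Y` is path connected and `(jA)_* : π₁(S³ ∖ L, a₀) → π₁(Y, jA a₀)` is SURJECTIVE —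
  `π₁` of a Dehn surgery is a quotient of the link group (Rolfsen (1976), §9.F; the easy half of
  the surgery presentation `π₁(S³_L) = π₁(S³ ∖ L) / ⟪λ₁, …, λₙ⟫`); packaged for
  `IsIntegralSurgeryLink` as `IsIntegralSurgeryLink.pathConnectedSpace_and_exists_surjective_map`.
* The ONE-component case is treated completely (surjectivity at the base point AND the kernel,
  `π₁(S³_m(K)) ≅ π₁(S³ ∖ K) ⧸ ⟪longitude⟫`) in `DehnSurgeryFundamentalGroup.lean`
  (`Knot.TubularNbhd.map_surjective_of_glue`, `…nonempty_mulEquiv_quotient_of_glue`), landed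
  while this file was written; with the tree's `Knot.TubularNbhd.normalClosure_meridian_eq_top`
  (Crowell–Fox VIII (1.1), `DehnSurgeryFramingProofs.lean`) it gives GST's sentence above for
  `n = 1` (`π₁` of a knot surgery is the normal closure of the image of the meridian) in two
  lines; the link-level statement needs the next brick below.

## What is NOT here (next bricks of the same programme)

The link group is normally generated by the `n` meridians (hence so is `π₁(S³_L)`, GST's
sentence for general `n`); the kernel of `π₁(S³ ∖ L) → π₁(S³_L)` is the normal closure of the
framing longitudes; `π₁(#ⁿ(S² × S¹))` is free of rank `n`; the meridians of the `0`-framed unlink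
form a free basis of `π₁` of its surgery; and the behaviour of the meridian classes under a strict
handle slide (GST §7, "the dual slide": `rⱼ ↦ rⱼ · (conjugate of rᵢ)`), which needs the slide
model `FramedLink.IsStrictHandleSlide.slideModel` of `KirbyMovesHandleSlide.lean`.

## References

* A. Hatcher, *Algebraic Topology*, Cambridge Univ. Press (2002), §1.2, Lemma 1.15, Thm. 1.20,
  Prop. 1.12, Prop. 1.18. [HatcherAT2002]
* D. Rolfsen, *Knots and Links*, Publish or Perish (1976), §3.A (link complements), §9.F
  (surgery along solid tori; the surgered manifold as the union of the link exterior and solid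
  tori). [Rolfsen1976]
* R. H. Crowell, R. H. Fox, *Introduction to Knot Theory* (1963), Ch. VIII (1.1). [CrowellFox1963]
* W. Hurewicz, H. Wallman, *Dimension Theory*, Princeton (1941), Ch. IV §5, Thm. IV 4.
  [HurewiczWallman1941]
* R. E. Gompf, M. Scharlemann, A. Thompson, *Fibered knots and potential counterexamples to the
  Property 2R and Slice-Ribbon Conjectures*, Geom. Topol. 14 (2010) 2305–2347, §7 (arXiv:1103.1601,
  p. 16, the paragraph after Conjecture 3). [GompfScharlemannThompson2010]

## Design notes

* All hypotheses of the gluing theorems are topological (`IsOpenEmbedding`), so they apply to the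
  smooth data of `IsIntegralSurgeryLink` / `Link.IsSurgeryPresentation` after
  `Manifold.IsSmoothEmbedding.isEmbedding`, in every model and universe; the surjection is proved
  at EVERY base point `a₀ ∈ S³ ∖ L` (the knot file works at `ν.basePoint`).
* The tubes `ν i` are only required to miss the OTHER components (implied by the pairwise
  disjointness of tubes recorded in `IsIntegralSurgeryLink`).
* Fundamental groups of subsets are handled with the tree's `VanKampen.inclHom` /
  `inclHomOfSubset` calculus (`VanKampenPushout.lean`, `VanKampenEpi.lean`, `InclHomTransport.lean`,
  `CellAttachmentPi1.lean`), following the pattern of Hatcher's Prop. 1.26 in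
  `CellAttachmentPi1.lean`.
* No declaration in this file uses `sorry`; no instance is registered globally.
-/

open scoped Manifold ContDiff Topology
open Set Function

noncomputable section

namespace Literature.Topology.FourManifolds

open Literature.AlgebraicTopology.FundamentalGroup
open Literature.AlgebraicTopology.FundamentalGroup.VanKampen

/-! ### The abstract van Kampen step: adding pieces whose `π₁` comes from the overlap -/

section Abstract

variable {Y : Type*} [TopologicalSpace Y]

/-- **Adding one piece (Hatcher, Lemma 1.15).** Let `A`, `B ⊆ Y` be open and path connected with
`A ∩ B` path connected, and suppose that at some `x₁ ∈ A ∩ B` the homomorphism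
`π₁(A ∩ B, x₁) → π₁(B, x₁)` is surjective. Then `π₁(A, x₀) → π₁(A ∪ B, x₀)` is surjective for
every `x₀ ∈ A`: by Lemma 1.15 `π₁(A ∪ B, x₁)` is generated by the images of `π₁(A)` and `π₁(B)`,
and the latter lies in the former; the base point is then moved inside `A` (Prop. 1.5).
[cite: HatcherAT2002, Lemma 1.15] -/
theorem surjective_inclHomOfSubset_union_of_surjective_inter {A B : Set Y} (hAo : IsOpen A)
    (hBo : IsOpen B) (hApc : IsPathConnected A) (hBpc : IsPathConnected B)
    (hmeet : IsPathConnected (A ∩ B)) {x₁ : Y} (hx₁A : x₁ ∈ A) (hx₁B : x₁ ∈ B)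
    (hgen : Function.Surjective
      (inclHomOfSubset (inter_subset_right : A ∩ B ⊆ B) x₁ ⟨hx₁A, hx₁B⟩ hx₁B))
    {x₀ : Y} (hx₀ : x₀ ∈ A) :
    Function.Surjective
      (inclHomOfSubset (subset_union_left : A ⊆ A ∪ B) x₀ hx₀ (subset_union_left hx₀)) := by
  -- the open cover of the subspace `W = A ∪ B`
  set W : Set Y := A ∪ B with hWdef
  set U : Set ↥W := Subtype.val ⁻¹' A with hUdef
  set T : Set ↥W := Subtype.val ⁻¹' B with hTdef
  have hUo : IsOpen U := hAo.preimage continuous_subtype_val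
  have hTo : IsOpen T := hBo.preimage continuous_subtype_val
  have hUT : U ∪ T = univ := by
    ext w
    simp only [hUdef, hTdef, mem_union, mem_preimage, mem_univ, iff_true]
    exact w.2
  have hUpc : IsPathConnected U := hApc.preimage_coe subset_union_left
  have hTpc : IsPathConnected T := hBpc.preimage_coe subset_union_right
  have hmeet' : IsPathConnected (U ∩ T) :=
    hmeet.preimage_coe (inter_subset_left.trans subset_union_left)
  have hx₁U : (⟨x₁, Or.inl hx₁A⟩ : ↥W) ∈ U := hx₁A
  have hx₁T : (⟨x₁, Or.inl hx₁A⟩ : ↥W) ∈ T := hx₁B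
  -- generation at `x₁` (Hatcher, Lemma 1.15)
  have hgenW := closure_range_inclHom_union_eq_top hUo hTo hUT hx₁U hx₁T hUpc hTpc hmeet'
  -- the hypothesis, transported into the subspace `W`
  obtain ⟨θA, θB, -, -, hcomm⟩ := exists_mulEquiv_preimageVal_comm
    (inter_subset_right : A ∩ B ⊆ B) (subset_union_right : B ⊆ W) (x₀ := x₁) ⟨hx₁A, hx₁B⟩
  have hgen' : Function.Surjective (inclHomOfSubset
      (fun _ hw => inter_subset_right hw : (Subtype.val ⁻¹' (A ∩ B) : Set ↥W) ⊆ Subtype.val ⁻¹' B)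
      ⟨x₁, subset_union_right (inter_subset_right ⟨hx₁A, hx₁B⟩)⟩ ⟨hx₁A, hx₁B⟩ hx₁B) :=
    (surjective_iff_of_mulEquiv_comm _ _ θA θB hcomm).1 hgen
  -- hence the image of `π₁(T)` lies in the image of `π₁(U)`, and `π₁(U, x₁) → π₁(W, x₁)` is onto
  have hsurj₁ : Function.Surjective (inclHom U _ hx₁U) := by
    rw [← MonoidHom.range_eq_top, ← top_le_iff, ← hgenW, Subgroup.closure_le, MonoidHom.coe_range]
    rintro b (hb | ⟨c, rfl⟩)
    · exact hb
    · obtain ⟨d, rfl⟩ := hgen' c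
      refine ⟨inclHomOfSubset (fun _ hw => inter_subset_left hw :
          (Subtype.val ⁻¹' (A ∩ B) : Set ↥W) ⊆ Subtype.val ⁻¹' A) _ ⟨hx₁A, hx₁B⟩ hx₁A d, ?_⟩
      change ((inclHom U _ hx₁U).comp (inclHomOfSubset _ _ _ hx₁U)) d =
        ((inclHom T _ hx₁T).comp (inclHomOfSubset _ _ _ hx₁T)) d
      rw [inclHom_comp_inclHomOfSubset, inclHom_comp_inclHomOfSubset]
  -- move the base point to `x₀` inside `U`
  have hx₀U : (⟨x₀, Or.inl hx₀⟩ : ↥W) ∈ U := hx₀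
  obtain ⟨δ, hδ⟩ := hUpc.joinedIn _ hx₀U _ hx₁U
  have hsurj₀ : Function.Surjective (inclHom U _ hx₀U) :=
    (surjective_inclHom_iff_of_path hx₀U hx₁U δ hδ).2 hsurj₁
  -- the two presentations of `π₁(A) → π₁(A ∪ B)`
  rw [surjective_inclHomOfSubset_iff_preimageVal]
  exact hsurj₀

/-- `π₁(↥univ, x₀) → π₁(Y, x₀)` is surjective (it is an isomorphism; only this half is needed).
[folklore] -/
theorem surjective_inclHom_univ (x₀ : Y) :
    Function.Surjective (inclHom (univ : Set Y) x₀ (mem_univ x₀)) := by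
  intro g
  induction g using PushoutData.ind_fromPath with
  | h γ => exact ⟨_, inclHom_fromPath_liftPath (mem_univ x₀) γ fun _ => mem_univ _⟩

/-- **Finitely many pieces.** Let `A` and `B i` (`i ∈ s`) be open and path connected, the `B i`
pairwise disjoint, each `A ∩ B i` path connected and containing a point `x₁ i` at which
`π₁(A ∩ B i) → π₁(B i)` is surjective. Then `A ∪ ⋃_{i ∈ s} B i` is path connected and
`π₁(A, x₀) → π₁(A ∪ ⋃_{i ∈ s} B i, x₀)` is surjective for every `x₀ ∈ A` (induction on `s`,
Hatcher (2002), Lemma 1.15 at each step). [cite: HatcherAT2002, Lemma 1.15] -/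
theorem surjective_inclHomOfSubset_union_biUnion {ι : Type*} {A : Set Y} {B : ι → Set Y}
    (hAo : IsOpen A) (hBo : ∀ i, IsOpen (B i)) (hApc : IsPathConnected A)
    (hBpc : ∀ i, IsPathConnected (B i)) (hmeet : ∀ i, IsPathConnected (A ∩ B i))
    (hdisj : Pairwise fun i j => Disjoint (B i) (B j)) (x₁ : ι → Y) (hx₁A : ∀ i, x₁ i ∈ A)
    (hx₁B : ∀ i, x₁ i ∈ B i)
    (hgen : ∀ i, Function.Surjective
      (inclHomOfSubset (inter_subset_right : A ∩ B i ⊆ B i) (x₁ i) ⟨hx₁A i, hx₁B i⟩ (hx₁B i)))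
    {x₀ : Y} (hx₀ : x₀ ∈ A) (s : Finset ι) :
    IsPathConnected (A ∪ ⋃ i ∈ s, B i) ∧
      Function.Surjective (inclHomOfSubset (subset_union_left : A ⊆ A ∪ ⋃ i ∈ s, B i) x₀ hx₀
        (subset_union_left hx₀)) := by
  classical
  induction s using Finset.induction_on with
  | empty =>
    have hset : A ∪ ⋃ i ∈ (∅ : Finset ι), B i = A := by simp
    refine ⟨by rw [hset]; exact hApc, ?_⟩
    rw [surjective_inclHomOfSubset_congr hset _ Subset.rfl hx₀]
    intro b
    refine ⟨b, ?_⟩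
    induction b using PushoutData.ind_fromPath with
    | h γ =>
      rw [inclHomOfSubset, _root_.FundamentalGroup.mapOfEq_apply]
      rfl
  | insert j s hj ih =>
    obtain ⟨hpc, hsurj⟩ := ih
    set A' : Set Y := A ∪ ⋃ i ∈ s, B i with hA'def
    have hset : A ∪ ⋃ i ∈ insert j s, B i = A' ∪ B j := by
      ext z
      simp only [hA'def, Finset.mem_insert, mem_union, mem_iUnion, exists_prop]
      constructor
      · rintro (hz | ⟨i, rfl | hi, hz⟩)
        · exact Or.inl (Or.inl hz)
        · exact Or.inr hz
        · exact Or.inl (Or.inr ⟨i, hi, hz⟩)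
      · rintro ((hz | ⟨i, hi, hz⟩) | hz)
        · exact Or.inl hz
        · exact Or.inr ⟨i, Or.inr hi, hz⟩
        · exact Or.inr ⟨j, Or.inl rfl, hz⟩
    have hinter : A' ∩ B j = A ∩ B j := by
      ext z
      simp only [hA'def, mem_inter_iff, mem_union, mem_iUnion, exists_prop]
      constructor
      · rintro ⟨hz | ⟨i, hi, hz⟩, hzj⟩
        · exact ⟨hz, hzj⟩
        · have hij : i ≠ j := fun h => hj (h ▸ hi)
          exact absurd hzj (Set.disjoint_left.mp (hdisj hij) hz)
      · rintro ⟨hz, hzj⟩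
        exact ⟨Or.inl hz, hzj⟩
    have hA'o : IsOpen A' := hAo.union (isOpen_biUnion fun i _ => hBo i)
    have hx₁A' : x₁ j ∈ A' := Or.inl (hx₁A j)
    have hmeet' : IsPathConnected (A' ∩ B j) := by rw [hinter]; exact hmeet j
    have hgen' : Function.Surjective (inclHomOfSubset (inter_subset_right : A' ∩ B j ⊆ B j)
        (x₁ j) ⟨hx₁A', hx₁B j⟩ (hx₁B j)) := by
      rw [surjective_inclHomOfSubset_congr' hinter rfl _ inter_subset_right _ ⟨hx₁A j, hx₁B j⟩]
      exact hgen j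
    have hstep := surjective_inclHomOfSubset_union_of_surjective_inter hA'o (hBo j) hpc (hBpc j)
      hmeet' hx₁A' (hx₁B j) hgen' (x₀ := x₀) (Or.inl hx₀)
    have hcomp := inclHomOfSubset_comp (Y := Y) (x₀ := x₀)
      (subset_union_left : A ⊆ A') (subset_union_left : A' ⊆ A' ∪ B j)
      hx₀ (subset_union_left hx₀) (subset_union_left (subset_union_left hx₀))
    refine ⟨?_, ?_⟩
    · rw [hset]
      exact hpc.union (hBpc j) ⟨x₁ j, hx₁A', hx₁B j⟩
    · rw [surjective_inclHomOfSubset_congr hset _ (subset_union_left.trans subset_union_left)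
        hx₀, ← hcomp, MonoidHom.coe_comp]
      exact hstep.comp hsurj

/-- **A finite family of pieces covering `Y`.** With `A`, `B i` as in
`surjective_inclHomOfSubset_union_biUnion` for all `i` of a finite index type and
`A ∪ ⋃ i, B i = Y`: `Y` is path connected and `π₁(A, x₀) → π₁(Y, x₀)` is surjective for every
`x₀ ∈ A`. [cite: HatcherAT2002, Lemma 1.15] -/
theorem surjective_inclHom_of_union_iUnion_eq_univ {ι : Type*} [Finite ι] {A : Set Y}
    {B : ι → Set Y} (hAo : IsOpen A) (hBo : ∀ i, IsOpen (B i)) (hApc : IsPathConnected A)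
    (hBpc : ∀ i, IsPathConnected (B i)) (hmeet : ∀ i, IsPathConnected (A ∩ B i))
    (hdisj : Pairwise fun i j => Disjoint (B i) (B j)) (x₁ : ι → Y) (hx₁A : ∀ i, x₁ i ∈ A)
    (hx₁B : ∀ i, x₁ i ∈ B i)
    (hgen : ∀ i, Function.Surjective
      (inclHomOfSubset (inter_subset_right : A ∩ B i ⊆ B i) (x₁ i) ⟨hx₁A i, hx₁B i⟩ (hx₁B i)))
    (hcov : A ∪ ⋃ i, B i = univ) {x₀ : Y} (hx₀ : x₀ ∈ A) :
    PathConnectedSpace Y ∧ Function.Surjective (inclHom A x₀ hx₀) := by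
  classical
  haveI := Fintype.ofFinite ι
  have hU : A ∪ ⋃ i ∈ (Finset.univ : Finset ι), B i = univ := by simpa using hcov
  obtain ⟨hpc, hsurj⟩ := surjective_inclHomOfSubset_union_biUnion hAo hBo hApc hBpc hmeet hdisj
    x₁ hx₁A hx₁B hgen hx₀ Finset.univ
  refine ⟨?_, ?_⟩
  · rw [hU] at hpc
    exact pathConnectedSpace_iff_univ.2 hpc
  · rw [surjective_inclHomOfSubset_congr hU _ (subset_univ A) hx₀] at hsurj
    have hcomp := inclHom_comp_inclHomOfSubset (subset_univ A) hx₀ (mem_univ x₀)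
    rw [← hcomp, MonoidHom.coe_comp]
    exact (surjective_inclHom_univ x₀).comp hsurj

end Abstract

/-! ### The complement of a link is path connected -/

section LinkComplement

open Literature.AlgebraicTopology.SingularHomology (pathConnectedSpace_sphere)

/-- Local notation: `𝔼 n` is the model Euclidean space `EuclideanSpace ℝ (Fin n)`. -/
local notation "𝔼 " n:arg => EuclideanSpace ℝ (Fin n)

/-- Local notation: `𝕊 n` is the unit sphere in `EuclideanSpace ℝ (Fin (n + 1))`. -/
local notation "𝕊 " n:arg => (Metric.sphere (0 : EuclideanSpace ℝ (Fin (n + 1))) 1)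

/-- **The complement of a link in `S³` is path connected** (a smooth link is a finite union of
`C¹` curves, a closed set of codimension `2`, which does not separate the connected `3`-sphere:
Hurewicz–Wallman (1941), Thm. IV 4, in the general-position form
`isPathConnected_compl_of_subset_iUnion_image` of the tree). Rolfsen (1976), §3.A.
[cite: HurewiczWallman1941, Ch. IV §5, Thm. IV 4] -/
theorem Link.isPathConnected_compl_carrier {ι : Type*} [Finite ι] (L : Link ι) :
    IsPathConnected L.carrierᶜ := by
  haveI : PathConnectedSpace (𝕊 3) := pathConnectedSpace_sphere (by norm_num)
  haveI : Countable ι := Finite.to_countable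
  have hdim : Module.finrank ℝ ℝ + 2 ≤ Module.finrank ℝ (𝔼 3) := by
    simp only [Module.finrank_self, finrank_euclideanSpace_fin]; norm_num
  have hSint : ∀ x ∈ L.carrier, (𝓡 3).IsInteriorPoint x := fun x _ ↦
    BoundarylessManifold.isInteriorPoint
  have hg : ∀ i, ContMDiffOn 𝓘(ℝ, ℝ) (𝓡 3) 1 (fun θ ↦ L.component i (circlePoint θ)) univ :=
    fun i ↦ (((L.component i).contMDiff.comp contMDiff_circlePoint).of_le
      (by exact_mod_cast le_top)).contMDiffOn
  have hSsub : L.carrier ⊆ ⋃ i, (fun θ ↦ L.component i (circlePoint θ)) '' univ := by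
    intro x hx
    obtain ⟨i, y, rfl⟩ := (L.mem_carrier_iff x).1 hx
    obtain ⟨θ, rfl⟩ := circlePoint_surjective y
    exact mem_iUnion.2 ⟨i, θ, mem_univ θ, rfl⟩
  exact isPathConnected_compl_of_subset_iUnion_image (I := 𝓡 3) hdim L.isClosed_carrier hSint
    (fun i θ ↦ L.component i (circlePoint θ)) (fun _ ↦ univ) (fun _ ↦ isOpen_univ) hg hSsub

/-- The complement of a link, as a space, is path connected.
[cite: HurewiczWallman1941, Ch. IV §5, Thm. IV 4] -/
theorem Link.pathConnectedSpace_complement {ι : Type*} [Finite ι] (L : Link ι) :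
    PathConnectedSpace L.complement :=
  isPathConnected_iff_pathConnectedSpace.1 L.isPathConnected_compl_carrier

end LinkComplement

/-! ### Loops in the open solid torus -/

section SolidTorus

/-- Local notation: `𝔼 n` is the model Euclidean space `EuclideanSpace ℝ (Fin n)`. -/
local notation "𝔼 " n:arg => EuclideanSpace ℝ (Fin n)

/-- Local notation: `𝕊 n` is the unit sphere in `EuclideanSpace ℝ (Fin (n + 1))`. -/
local notation "𝕊 " n:arg => (Metric.sphere (0 : EuclideanSpace ℝ (Fin (n + 1))) 1)

/-- The open solid torus is path connected (a product of the convex open disc and the circle).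
[folklore] -/
theorem isPathConnected_solidTorus : IsPathConnected (solidTorus : Set ((𝔼 2) × (𝕊 1))) := by
  have h1 : IsPathConnected (Metric.ball (0 : 𝔼 2) 1) :=
    (convex_ball (0 : 𝔼 2) 1).isPathConnected ⟨0, Metric.mem_ball_self one_pos⟩
  have : ((solidTorus : TopologicalSpace.Opens ((𝔼 2) × (𝕊 1))) : Set ((𝔼 2) × (𝕊 1))) =
      Metric.ball (0 : 𝔼 2) 1 ×ˢ univ := rfl
  have h2 : IsPathConnected (univ : Set (𝕊 1)) := by
    -- the circle is path connected (the knot file `DehnSurgeryFundamentalGroup.lean` records this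
    -- as `Knot.TubularNbhd.isPathConnected_univ_sphere_one`; kept local here)
    have hrank : 1 < Module.rank ℝ (𝔼 2) := by
      rw [← Module.finrank_eq_rank, finrank_euclideanSpace_fin]; norm_num
    haveI := isPathConnected_iff_pathConnectedSpace.1
      (isPathConnected_sphere hrank (0 : 𝔼 2) zero_le_one)
    exact isPathConnected_univ
  rw [this]
  exact h1.prod h2

/-- **Every loop of the open solid torus is homotopic to a loop off the core**: for a base point
`b₁` off the core circle, `π₁((D̊² ∖ 0) × S¹, b₁) → π₁(D̊² × S¹, b₁)` is surjective — the
straight-line homotopy in the disc factor pushes a loop `(w(t), v(t))` to the loop `(w₁, v(t))`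
on the torus through `b₁ = (w₁, v₁)` (both groups are `π₁(S¹) = ℤ`, generated by the core
class; Hatcher (2002), Prop. 1.12). [cite: HatcherAT2002, Prop. 1.12] -/
theorem surjective_inclHom_puncturedSolidTorus {b₁ : ↥solidTorus}
    (hb₁ : b₁ ∈ {b : ↥solidTorus | (b : (𝔼 2) × (𝕊 1)).1 ≠ 0}) :
    Function.Surjective (inclHom {b : ↥solidTorus | (b : (𝔼 2) × (𝕊 1)).1 ≠ 0} b₁ hb₁) := by
  intro g
  induction g using PushoutData.ind_fromPath with
  | h γ =>
  set w₁ : 𝔼 2 := (b₁ : (𝔼 2) × (𝕊 1)).1 with hw₁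
  have hw₁lt : ‖w₁‖ < 1 := (mem_solidTorus_iff _).1 b₁.2
  -- the straight-line homotopy stays inside the solid torus (the disc is convex)
  have hmem : ∀ (s t : unitInterval),
      (((1 - (s : ℝ)) • ((γ t : ↥solidTorus) : (𝔼 2) × (𝕊 1)).1 + (s : ℝ) • w₁,
        ((γ t : ↥solidTorus) : (𝔼 2) × (𝕊 1)).2) : (𝔼 2) × (𝕊 1)) ∈ solidTorus := by
    intro s t
    rw [mem_solidTorus_iff]
    have ha : ((γ t : ↥solidTorus) : (𝔼 2) × (𝕊 1)).1 ∈ Metric.ball (0 : 𝔼 2) 1 :=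
      mem_ball_zero_iff.2 ((mem_solidTorus_iff _).1 (γ t).2)
    have hw : w₁ ∈ Metric.ball (0 : 𝔼 2) 1 := mem_ball_zero_iff.2 hw₁lt
    exact mem_ball_zero_iff.1
      ((convex_ball (0 : 𝔼 2) 1) ha hw (sub_nonneg.2 s.2.2) s.2.1 (sub_add_cancel 1 _))
  have hcoe : ∀ t, ((γ t : ↥solidTorus) : (𝔼 2) × (𝕊 1)) ∈ solidTorus := fun t ↦ (γ t).2
  have h0 : ((γ 0 : ↥solidTorus) : (𝔼 2) × (𝕊 1)) = (w₁, (b₁ : (𝔼 2) × (𝕊 1)).2) := by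
    rw [γ.source]
  have h1 : ((γ 1 : ↥solidTorus) : (𝔼 2) × (𝕊 1)) = (w₁, (b₁ : (𝔼 2) × (𝕊 1)).2) := by
    rw [γ.target]
  -- the slice loop through `b₁`
  let γ' : Path b₁ b₁ :=
    { toFun := fun t ↦ ⟨(w₁, ((γ t : ↥solidTorus) : (𝔼 2) × (𝕊 1)).2),
        (mem_solidTorus_iff _).2 hw₁lt⟩
      continuous_toFun := (continuous_const.prodMk (continuous_snd.comp
        (continuous_subtype_val.comp γ.continuous))).subtype_mk _
      source' := by
        apply Subtype.ext
        change (w₁, ((γ 0 : ↥solidTorus) : (𝔼 2) × (𝕊 1)).2) = (b₁ : (𝔼 2) × (𝕊 1))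
        rw [h0]
      target' := by
        apply Subtype.ext
        change (w₁, ((γ 1 : ↥solidTorus) : (𝔼 2) × (𝕊 1)).2) = (b₁ : (𝔼 2) × (𝕊 1))
        rw [h1] }
  have hγ' : ∀ t, γ' t ∈ {b : ↥solidTorus | (b : (𝔼 2) × (𝕊 1)).1 ≠ 0} := fun t ↦ hb₁
  -- the homotopy
  have hcont : Continuous fun p : unitInterval × unitInterval ↦
      ((γ p.2 : ↥solidTorus) : (𝔼 2) × (𝕊 1)) :=
    continuous_subtype_val.comp (γ.continuous.comp continuous_snd)
  let F : Path.Homotopy γ γ' :=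
    { toFun := fun p ↦ ⟨((1 - (p.1 : ℝ)) • ((γ p.2 : ↥solidTorus) : (𝔼 2) × (𝕊 1)).1 +
          (p.1 : ℝ) • w₁, ((γ p.2 : ↥solidTorus) : (𝔼 2) × (𝕊 1)).2), hmem p.1 p.2⟩
      continuous_toFun := by
        refine Continuous.subtype_mk (Continuous.prodMk ?_ (continuous_snd.comp hcont)) _
        exact ((continuous_const.sub (continuous_subtype_val.comp continuous_fst)).smul
          (continuous_fst.comp hcont)).add
          ((continuous_subtype_val.comp continuous_fst).smul continuous_const)
      map_zero_left := fun t ↦ by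
        apply Subtype.ext
        change ((1 - ((0 : unitInterval) : ℝ)) • ((γ t : ↥solidTorus) : (𝔼 2) × (𝕊 1)).1 +
          ((0 : unitInterval) : ℝ) • w₁, ((γ t : ↥solidTorus) : (𝔼 2) × (𝕊 1)).2) =
          ((γ t : ↥solidTorus) : (𝔼 2) × (𝕊 1))
        rw [Set.Icc.coe_zero, sub_zero, one_smul, zero_smul, add_zero]
      map_one_left := fun t ↦ by
        apply Subtype.ext
        change ((1 - ((1 : unitInterval) : ℝ)) • ((γ t : ↥solidTorus) : (𝔼 2) × (𝕊 1)).1 +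
          ((1 : unitInterval) : ℝ) • w₁, ((γ t : ↥solidTorus) : (𝔼 2) × (𝕊 1)).2) =
          (w₁, ((γ t : ↥solidTorus) : (𝔼 2) × (𝕊 1)).2)
        rw [Set.Icc.coe_one, sub_self, zero_smul, one_smul, zero_add]
      prop' := fun s t ht ↦ by
        apply Subtype.ext
        change ((1 - (s : ℝ)) • ((γ t : ↥solidTorus) : (𝔼 2) × (𝕊 1)).1 + (s : ℝ) • w₁,
          ((γ t : ↥solidTorus) : (𝔼 2) × (𝕊 1)).2) = ((γ t : ↥solidTorus) : (𝔼 2) × (𝕊 1))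
        rcases ht with rfl | ht
        · rw [h0, ← add_smul, sub_add_cancel, one_smul]
        · rw [Set.mem_singleton_iff] at ht
          subst ht
          rw [h1, ← add_smul, sub_add_cancel, one_smul] }
  refine ⟨_root_.FundamentalGroup.fromPath
    (Path.Homotopic.Quotient.mk
      (liftPath {b : ↥solidTorus | (b : (𝔼 2) × (𝕊 1)).1 ≠ 0} γ' hγ')), ?_⟩
  rw [inclHom_fromPath_liftPath]
  exact congrArg (fun p ↦ _root_.FundamentalGroup.fromPath p)
    (Path.Homotopic.Quotient.eq.2 (⟨F⟩ : γ.Homotopic γ')).symm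

/-- The punctured open unit disc of `ℝ²` is path connected (it is the image of
`(0, 1) × S¹` under `(t, u) ↦ t • u`). [folklore] -/
theorem isPathConnected_ball_diff_zero_euclideanTwo :
    IsPathConnected (Metric.ball (0 : 𝔼 2) 1 \ {0}) := by
  have hdom : IsPathConnected (Ioo (0 : ℝ) 1 ×ˢ (univ : Set (𝕊 1))) :=
    ((convex_Ioo (0 : ℝ) 1).isPathConnected ⟨1 / 2, by norm_num, by norm_num⟩).prod
      (by
        have hrank : 1 < Module.rank ℝ (𝔼 2) := by
          rw [← Module.finrank_eq_rank, finrank_euclideanSpace_fin]; norm_num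
        haveI := isPathConnected_iff_pathConnectedSpace.1
          (isPathConnected_sphere hrank (0 : 𝔼 2) zero_le_one)
        exact isPathConnected_univ)
  have hcont : Continuous fun p : ℝ × (𝕊 1) ↦ p.1 • (p.2 : 𝔼 2) :=
    continuous_fst.smul (continuous_subtype_val.comp continuous_snd)
  have himage : (fun p : ℝ × (𝕊 1) ↦ p.1 • (p.2 : 𝔼 2)) '' (Ioo (0 : ℝ) 1 ×ˢ univ) =
      Metric.ball (0 : 𝔼 2) 1 \ {0} := by
    ext w
    simp only [mem_image, mem_prod, mem_Ioo, mem_univ, and_true, Prod.exists, mem_sdiff,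
      mem_ball_zero_iff, mem_singleton_iff]
    constructor
    · rintro ⟨t, u, ⟨ht0, ht1⟩, rfl⟩
      refine ⟨?_, smul_ne_zero ht0.ne' (ne_zero_of_mem_unit_sphere u)⟩
      rw [norm_smul, norm_eq_of_mem_sphere u, mul_one, Real.norm_of_nonneg ht0.le]
      exact ht1
    · rintro ⟨hw1, hw0⟩
      have hn : 0 < ‖w‖ := norm_pos_iff.2 hw0
      refine ⟨‖w‖, ⟨‖w‖⁻¹ • w, ?_⟩, ⟨hn, hw1⟩, ?_⟩
      · rw [mem_sphere_zero_iff_norm, norm_smul, norm_inv, norm_norm, inv_mul_cancel₀ hn.ne']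
      · change ‖w‖ • (‖w‖⁻¹ • w) = w
        rw [smul_inv_smul₀ hn.ne']
  rw [← himage]
  exact hdom.image hcont

/-- The punctured solid torus is path connected. [folklore] -/
theorem isPathConnected_puncturedSolidTorus :
    IsPathConnected {b : ↥solidTorus | (b : (𝔼 2) × (𝕊 1)).1 ≠ 0} := by
  have hP : IsPathConnected ((Metric.ball (0 : 𝔼 2) 1 \ {0}) ×ˢ (univ : Set (𝕊 1))) :=
    isPathConnected_ball_diff_zero_euclideanTwo.prod
      (by
        have hrank : 1 < Module.rank ℝ (𝔼 2) := by
          rw [← Module.finrank_eq_rank, finrank_euclideanSpace_fin]; norm_num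
        haveI := isPathConnected_iff_pathConnectedSpace.1
          (isPathConnected_sphere hrank (0 : 𝔼 2) zero_le_one)
        exact isPathConnected_univ)
  have hsub : (Metric.ball (0 : 𝔼 2) 1 \ {0}) ×ˢ (univ : Set (𝕊 1)) ⊆
      (solidTorus : Set ((𝔼 2) × (𝕊 1))) := by
    rintro ⟨w, v⟩ ⟨⟨hw, -⟩, -⟩
    exact (mem_solidTorus_iff _).2 (mem_ball_zero_iff.1 hw)
  have heq : ({b : ↥solidTorus | (b : (𝔼 2) × (𝕊 1)).1 ≠ 0} : Set ↥solidTorus) =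
      Subtype.val ⁻¹' ((Metric.ball (0 : 𝔼 2) 1 \ {0}) ×ˢ (univ : Set (𝕊 1))) := by
    ext b
    simp only [mem_setOf_eq, mem_preimage, mem_prod, mem_sdiff,
      mem_ball_zero_iff, mem_singleton_iff, mem_univ, and_true]
    exact ⟨fun h ↦ ⟨(mem_solidTorus_iff _).1 b.2, h⟩, fun h ↦ h.2⟩
  rw [heq]
  exact hP.preimage_coe hsub

/-- The standard base point `(e₀, 1)` of the solid torus, `e₀ = (½, 0)`, lies in the open solid
torus. [folklore] -/
theorem framingBaseVector_mem_solidTorus :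
    ((framingBaseVector, circlePoint 0) : (𝔼 2) × (𝕊 1)) ∈ solidTorus := by
  rw [mem_solidTorus_iff]
  change ‖framingBaseVector‖ < 1
  rw [framingBaseVector, norm_smul, norm_eq_of_mem_sphere, mul_one, Real.norm_of_nonneg]
    <;> norm_num

end SolidTorus

/-! ### The fundamental group of a Dehn surgery is a quotient of the link group -/

section Surgery

/-- Local notation: `𝔼 n` is the model Euclidean space `EuclideanSpace ℝ (Fin n)`. -/
local notation "𝔼 " n:arg => EuclideanSpace ℝ (Fin n)

/-- Local notation: `𝕊 n` is the unit sphere in `EuclideanSpace ℝ (Fin (n + 1))`. -/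
local notation "𝕊 " n:arg => (Metric.sphere (0 : EuclideanSpace ℝ (Fin (n + 1))) 1)

variable {ι : Type*} [Finite ι] {L : Link ι} {ν : ∀ i, Knot.TubularNbhd (L.component i)}
  {Y : Type*} [TopologicalSpace Y] {jA : L.complement → Y} {jB : ι → ↥solidTorus → Y}

omit [TopologicalSpace Y] in
/-- **The two pieces of a Dehn surgery overlap in the punctured solid tori.** In a gluing of the
link complement and of one open solid torus per component along the surgery relations
`Link.surgeryRel ν i` (the `i`-th tube `ν i` missing the other components), the image of the
link complement meets the image of the `i`-th solid torus exactly in the image of the punctured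
solid torus `(D̊² ∖ 0) × S¹`. [cite: Rolfsen1976, §9.F] -/
theorem range_inter_range_eq_image_puncturedSolidTorus
    (hν : ∀ ⦃i k : ι⦄, i ≠ k → Disjoint (range ⇑(ν i)) (range ⇑(L.component k)))
    (hrel : ∀ i a b, jA a = jB i b ↔ Link.surgeryRel ν i a b) (i : ι) :
    range jA ∩ range (jB i) = jB i '' {b : ↥solidTorus | (b : (𝔼 2) × (𝕊 1)).1 ≠ 0} := by
  ext y
  constructor
  · rintro ⟨⟨a, rfl⟩, b, hb⟩
    have h := (hrel i a b).1 hb.symm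
    refine ⟨b, ?_, hb⟩
    rw [mem_setOf_eq, ← norm_pos_iff]
    exact (Knot.TubularNbhd.glueRel.norm_fst_mem_Ioo h).1
  · rintro ⟨b, hb, rfl⟩
    rw [mem_setOf_eq] at hb
    set w : 𝔼 2 := (b : (𝔼 2) × (𝕊 1)).1 with hw
    have hn : 0 < ‖w‖ := norm_pos_iff.2 hb
    have hw1 : ‖w‖ < 1 := (mem_solidTorus_iff _).1 b.2
    set u : 𝕊 1 := ⟨‖w‖⁻¹ • w, by
      rw [mem_sphere_zero_iff_norm, norm_smul, norm_inv, norm_norm, inv_mul_cancel₀ hn.ne']⟩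
      with hu
    have htv : ‖w‖ • ((b : (𝔼 2) × (𝕊 1)).2 : 𝔼 2) ≠ 0 :=
      smul_ne_zero hn.ne' (ne_zero_of_mem_unit_sphere _)
    set a₀ : 𝕊 3 := ν i (u, ‖w‖ • ((b : (𝔼 2) × (𝕊 1)).2 : 𝔼 2)) with ha₀
    have ha₀L : a₀ ∈ L.complement := by
      rw [Link.mem_complement_iff]
      intro k
      by_cases hk : i = k
      · subst hk
        exact (ν i).apply_mem_compl_range htv
      · exact fun hmem ↦ Set.disjoint_left.1 (hν hk) (mem_range_self _) hmem
    refine ⟨⟨⟨a₀, ha₀L⟩, ?_⟩, mem_range_self b⟩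
    rw [hrel i]
    refine ⟨u, ‖w‖, ⟨hn, hw1⟩, ?_, rfl⟩
    change w = ‖w‖ • (‖w‖⁻¹ • w)
    rw [smul_inv_smul₀ hn.ne']

/-- **The fundamental group of a Dehn surgery is carried by the link complement (van Kampen).**
Let `Y` be glued from the complement `S³ ∖ L` of a link with finitely many components and one
open solid torus `D̊² × S¹` per component, along the surgery relations of pairwise disjoint
tubes `ν i` (open embeddings `jA`, `jB i` with `Y = jA(S³ ∖ L) ∪ ⋃ᵢ jB i (D̊² × S¹)`, the solid
tori pairwise disjoint, `jA a = jB i b ↔ Link.surgeryRel ν i a b` — the gluing data of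
`IsIntegralSurgeryLink`). Then `Y` is path connected and, for every `a₀ ∈ S³ ∖ L`, the
homomorphism `π₁(jA(S³ ∖ L), jA a₀) → π₁(Y, jA a₀)` induced by the inclusion is surjective:
`jA(S³ ∖ L)` meets `jB i (D̊² × S¹)` in the punctured solid torus, which is path connected and
carries `π₁` of the solid torus, so Seifert–van Kampen (Hatcher (2002), Lemma 1.15) applies one
torus at a time. This is the first half of the surgery presentation
`π₁(S³_L) = π₁(S³ ∖ L) / ⟪λ₁, …, λₙ⟫` (Rolfsen (1976), §9.F; Gompf–Scharlemann–Thompson (2010),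
§7: the meridians of `L` give `n` elements of `G = π₁` of the surgered manifold that normally
generate it). [cite: HatcherAT2002, Lemma 1.15] [cite: Rolfsen1976, §9.F] -/
theorem pathConnectedSpace_and_surjective_inclHom_range_of_surgeryGluing
    (hν : ∀ ⦃i k : ι⦄, i ≠ k → Disjoint (range ⇑(ν i)) (range ⇑(L.component k)))
    (hjA : Topology.IsOpenEmbedding jA) (hjB : ∀ i, Topology.IsOpenEmbedding (jB i))
    (hcov : range jA ∪ (⋃ i, range (jB i)) = univ)
    (hdisj : Pairwise fun i j ↦ Disjoint (range (jB i)) (range (jB j)))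
    (hrel : ∀ i a b, jA a = jB i b ↔ Link.surgeryRel ν i a b) (a₀ : L.complement) :
    PathConnectedSpace Y ∧
      Function.Surjective (inclHom (range jA) (jA a₀) (mem_range_self a₀)) := by
  -- the base point of the `i`-th solid torus
  set b₀ : ↥solidTorus := ⟨(framingBaseVector, circlePoint 0), framingBaseVector_mem_solidTorus⟩
    with hb₀
  have hb₀p : b₀ ∈ {b : ↥solidTorus | (b : (𝔼 2) × (𝕊 1)).1 ≠ 0} := framingBaseVector_ne_zero
  have hinter := range_inter_range_eq_image_puncturedSolidTorus hν hrel
  have hx₁A : ∀ i, jB i b₀ ∈ range jA := fun i ↦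
    ((hinter i).symm ▸ mem_image_of_mem (jB i) hb₀p : jB i b₀ ∈ range jA ∩ range (jB i)).1
  haveI := L.pathConnectedSpace_complement
  haveI : PathConnectedSpace ↥solidTorus :=
    isPathConnected_iff_pathConnectedSpace.1 isPathConnected_solidTorus
  refine surjective_inclHom_of_union_iUnion_eq_univ hjA.isOpen_range
    (fun i ↦ (hjB i).isOpen_range) (isPathConnected_range hjA.continuous)
    (fun i ↦ isPathConnected_range (hjB i).continuous) (fun i ↦ ?_) hdisj (fun i ↦ jB i b₀)
    hx₁A (fun i ↦ mem_range_self b₀) (fun i ↦ ?_) hcov (mem_range_self a₀)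
  · rw [hinter i]
    exact isPathConnected_puncturedSolidTorus.image (hjB i).continuous
  · rw [← surjective_inclHomOfSubset_congr' (hinter i).symm rfl (image_subset_range _ _)
      inter_subset_right (mem_image_of_mem (jB i) hb₀p) ⟨hx₁A i, mem_range_self b₀⟩]
    exact (surjective_inclHom_iff_image_of_isEmbedding (hjB i).isEmbedding hb₀p).1
      (surjective_inclHom_puncturedSolidTorus hb₀p)

/-- **`π₁(S³ ∖ L) → π₁(S³_L)` is surjective** (the form with Mathlib's `FundamentalGroup.map` of
the gluing embedding `jA : S³ ∖ L → Y`): every loop of the surgered manifold at `jA a₀` is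
homotopic to the image of a loop of the link complement at `a₀`. Hence `π₁` of a Dehn surgery on
`L` is a quotient of the link group `π₁(S³ ∖ L)`; with
`Knot.TubularNbhd.normalClosure_meridian_eq_top` (knots) it is normally generated by the image of
the meridian. Rolfsen (1976), §9.F; Gompf–Scharlemann–Thompson (2010), §7.
[cite: Rolfsen1976, §9.F] [cite: HatcherAT2002, Lemma 1.15] -/
theorem surjective_fundamentalGroup_map_of_surgeryGluing
    (hν : ∀ ⦃i k : ι⦄, i ≠ k → Disjoint (range ⇑(ν i)) (range ⇑(L.component k)))
    (hjA : Topology.IsOpenEmbedding jA) (hjB : ∀ i, Topology.IsOpenEmbedding (jB i))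
    (hcov : range jA ∪ (⋃ i, range (jB i)) = univ)
    (hdisj : Pairwise fun i j ↦ Disjoint (range (jB i)) (range (jB j)))
    (hrel : ∀ i a b, jA a = jB i b ↔ Link.surgeryRel ν i a b) (a₀ : L.complement) :
    Function.Surjective (_root_.FundamentalGroup.map ⟨jA, hjA.continuous⟩ a₀) := by
  have hsurj := (pathConnectedSpace_and_surjective_inclHom_range_of_surgeryGluing hν hjA hjB
    hcov hdisj hrel a₀).2
  -- `π₁(S³ ∖ L, a₀) ≅ π₁(jA(S³ ∖ L), jA a₀)` along the embedding, compatibly with the two maps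
  let η : ↥L.complement ≃ₜ ↥(range jA) := hjA.isEmbedding.toHomeomorph
  have hη : η a₀ = ⟨jA a₀, mem_range_self a₀⟩ := Subtype.ext rfl
  have key : ∀ g, inclHom (range jA) (jA a₀) (mem_range_self a₀)
      (fundamentalGroupEquivOfHomeomorph η hη g) =
      _root_.FundamentalGroup.map ⟨jA, hjA.continuous⟩ a₀ g := by
    intro g
    rw [fundamentalGroupEquivOfHomeomorph_apply, _root_.FundamentalGroup.map_eq_mapOfEq]
    induction g using PushoutData.ind_fromPath with
    | h γ =>
      rw [inclHom, _root_.FundamentalGroup.mapOfEq_apply, _root_.FundamentalGroup.mapOfEq_apply,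
        _root_.FundamentalGroup.mapOfEq_apply]
      exact congrArg (fun p ↦ _root_.FundamentalGroup.fromPath (Path.Homotopic.Quotient.mk p))
        (by ext t; rfl)
  intro g
  obtain ⟨g₁, rfl⟩ := hsurj g
  refine ⟨(fundamentalGroupEquivOfHomeomorph η hη).symm g₁, ?_⟩
  rw [← key, MulEquiv.apply_symm_apply]

/-- **Corollary (surgery on a framed link).** If `Y` is integral Dehn surgery on the link `L`
(`IsIntegralSurgeryLink`, any model), then `Y` is path connected and `π₁(Y)` is a quotient of the
link group: there is a gluing embedding `jA : S³ ∖ L → Y` inducing a surjection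
`π₁(S³ ∖ L, a₀) → π₁(Y, jA a₀)` at every `a₀`. [cite: Rolfsen1976, §9.F] -/
theorem IsIntegralSurgeryLink.pathConnectedSpace_and_exists_surjective_map
    {EY HY : Type*} [NormedAddCommGroup EY] [NormedSpace ℝ EY] [TopologicalSpace HY]
    {IY : ModelWithCorners ℝ EY HY} [ChartedSpace HY Y] {m : ι → ℤ}
    (h : IsIntegralSurgeryLink IY Y L m) :
    PathConnectedSpace Y ∧ ∃ jA : C(↥L.complement, Y), Topology.IsOpenEmbedding jA ∧
      ∀ a₀, Function.Surjective (_root_.FundamentalGroup.map jA a₀) := by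
  obtain ⟨ν, -, hνν, jA, jB, hjA, hjAo, hjB, hcov, hdisj, hrel⟩ := h
  have hν : ∀ ⦃i k : ι⦄, i ≠ k → Disjoint (range ⇑(ν i)) (range ⇑(L.component k)) :=
    fun i k hik ↦ (hνν hik).mono_right (ν k).range_subset_range
  have hjA' : Topology.IsOpenEmbedding jA := ⟨hjA.isEmbedding, hjAo⟩
  have hjB' : ∀ i, Topology.IsOpenEmbedding (jB i) := fun i ↦ ⟨(hjB i).1.isEmbedding, (hjB i).2⟩
  obtain ⟨a₀⟩ : Nonempty ↥L.complement := by
    haveI := L.pathConnectedSpace_complement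
    infer_instance
  refine ⟨(pathConnectedSpace_and_surjective_inclHom_range_of_surgeryGluing hν hjA' hjB' hcov
    hdisj hrel a₀).1, ⟨jA, hjA'.continuous⟩, hjA', fun a ↦ ?_⟩
  exact surjective_fundamentalGroup_map_of_surgeryGluing hν hjA' hjB' hcov hdisj hrel a

end Surgery


end Literature.Topology.FourManifolds
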